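import Mathlib.Algebra.Order.Field.Power
import Mathlib.Data.NNReal.Basic
import Mathlib.Algebra.Order.BigOperators.Group.Finset
import Mathlib.Algebra.Group.Hom.End
import HarnessLib

/-!
# Coboundaries by successive approximation in a complete filtered abelian group

Topic `NumberTheory/EllipticCurves` (the abstract step of the proof that `H¹` of an unramified
cyclic Galois group with values in the formal group `Ê(𝓜) = E₁(L)` of an elliptic curve with
good reduction vanishes; Milne, *Arithmetic Duality Theorems*, proof of Prop. I.3.8, Lang–Tate).

Let `A` be an abelian group with an ultrametric "absolute value" `N : A → ℝ≥0` (`N a = 0 ↔ a = 0`,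
`N (-a) = N a`, `N (a + b) ≤ max (N a) (N b)`) taking its non-zero values in `{θ, θ², …}` for
some `0 < θ < 1`, complete in the sense that every sequence `s` with `N (s j - s i) ≤ θⁱ⁺¹ N₀`
(`i ≤ j`) has a limit, and let `ψ : A →+ A` be an `N`-isometry of finite order `n`. Suppose the
**graded pieces have no `H¹`**: whenever `N a ≤ θⁱ⁺¹` and the "norm" `Σ_{j<n} ψʲ a` is
`≤ θⁱ⁺²`, there is `t` with `N t ≤ θⁱ⁺¹` and `N (a - (ψ t - t)) ≤ θⁱ⁺²`. Then **every `a` with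
`Σ_{j<n} ψʲ a = 0` is a coboundary**: `a = ψ t - t` with `N t ≤ N a`
(`FilteredCoboundary.exists_eq_sub`). This is the usual dévissage "a complete filtered module
whose graded quotients are cohomologically trivial is cohomologically trivial" (Serre, *Local
Fields*, Ch. V §2, Lemma 2 / Ch. XII §3, Lemma 3), written out for `H¹` of a cyclic group by
successive approximation so that no cohomological machinery is needed; the consumer is the
kernel of reduction `E₁(L)` of a good model over a finite unramified extension `L` of `K_v`
with `N = |z(·)|_v` (file `FormalGroupChart`).

## References

* J.-P. Serre, *Local Fields*, GTM 67, Springer 1979, Ch. V §2 Lemma 2; Ch. XII §3 Lemma 3.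
* J. S. Milne, *Arithmetic Duality Theorems*, 2nd ed. 2006, Ch. I, proof of Prop. 3.8.

## Design

Everything is a hypothesis on `(A, N, θ, ψ, n)`; no topology is used (completeness is the
explicit Cauchy-sequence statement `hcomplete`), so that the consumer can verify it from the
completeness of a finite extension of `K_v` through an isometric embedding.
-/

noncomputable section

open scoped NNReal

namespace Literature.NumberTheory.EllipticCurves

namespace FilteredCoboundary

variable {A : Type*} [AddCommGroup A]

/-- `Σ_{j<n} ψʲ` applied to `a` (the "norm" of the cyclic group generated by `ψ`). [folklore] -/
def normSum (ψ : AddMonoid.End A) (n : ℕ) (a : A) : A := ∑ j ∈ Finset.range n, (ψ ^ j) a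

/-- `normSum` is additive. [folklore] -/
theorem normSum_sub (ψ : AddMonoid.End A) (n : ℕ) (a b : A) :
    normSum ψ n (a - b) = normSum ψ n a - normSum ψ n b := by
  simp [normSum]

/-- Telescoping: `Σ_{j<n} ψʲ (ψ t - t) = ψⁿ t - t`. [folklore] -/
theorem normSum_sub_self (ψ : AddMonoid.End A) (n : ℕ) (t : A) :
    normSum ψ n (ψ t - t) = (ψ ^ n) t - t := by
  induction n with
  | zero => simp [normSum]
  | succ n ih =>
    rw [normSum, Finset.sum_range_succ, ← normSum, ih, map_sub, pow_succ,
      AddMonoid.End.coe_mul, Function.comp_apply]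
    abel

/-- **Coboundaries by successive approximation.** See the module docstring: for an ultrametric
`N : A → ℝ≥0` with values in `{0} ∪ {θⁱ⁺¹}`, complete, an `N`-isometry `ψ` of order `n`, and
graded pieces without `H¹`, every `a` with `Σ_{j<n} ψʲ a = 0` is `ψ t - t` with `N t ≤ N a`.
(Serre, *Local Fields*, Ch. V §2 Lemma 2, for `H¹` of a cyclic group, by successive
approximation.) [folklore] -/
theorem exists_eq_sub (N : A → ℝ≥0) (θ : ℝ≥0) (hθ1 : θ < 1)
    (hN0 : ∀ a, N a = 0 ↔ a = 0) (hNneg : ∀ a, N (-a) = N a)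
    (hNadd : ∀ a b, N (a + b) ≤ max (N a) (N b))
    (hval : ∀ a, a ≠ 0 → ∃ i : ℕ, N a = θ ^ (i + 1))
    (hcomplete : ∀ s : ℕ → A, (∀ i j, i ≤ j → N (s j - s i) ≤ θ ^ (i + 1)) →
      ∃ S, ∀ i, N (s i - S) ≤ θ ^ (i + 1))
    (ψ : AddMonoid.End A) (hψN : ∀ a, N (ψ a) = N a) (n : ℕ) (hψn : ∀ a, (ψ ^ n) a = a)
    (hgr : ∀ (i : ℕ) (a : A), N a ≤ θ ^ (i + 1) → N (normSum ψ n a) ≤ θ ^ (i + 2) →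
      ∃ t, N t ≤ θ ^ (i + 1) ∧ N (a - (ψ t - t)) ≤ θ ^ (i + 2))
    (a : A) (ha : normSum ψ n a = 0) :
    ∃ t, ψ t - t = a ∧ N t ≤ N a := by
  -- ultrametric consequences
  have hNsub : ∀ a b, N (a - b) ≤ max (N a) (N b) := fun a b ↦ by
    rw [sub_eq_add_neg]; exact (hNadd a (-b)).trans (by rw [hNneg])
  have hNzero : N 0 = 0 := (hN0 0).mpr rfl
  by_cases ha0 : a = 0
  · exact ⟨0, by simp [ha0], by simp [ha0, hNzero]⟩
  obtain ⟨i₀, hi₀⟩ := hval a ha0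
  -- the graded step, packaged: from an error `e` at level `i₀ + i` with vanishing norm sum,
  -- produce `t` and the new error
  have step : ∀ (i : ℕ) (e : A), N e ≤ θ ^ (i₀ + i + 1) → normSum ψ n e = 0 →
      ∃ t, N t ≤ θ ^ (i₀ + i + 1) ∧ N (e - (ψ t - t)) ≤ θ ^ (i₀ + i + 2) ∧
        normSum ψ n (e - (ψ t - t)) = 0 := by
    intro i e he hne
    obtain ⟨t, ht, het⟩ := hgr (i₀ + i) e he (by rw [hne, hNzero]; exact zero_le)
    refine ⟨t, ht, het, ?_⟩
    rw [normSum_sub, hne, normSum_sub_self, hψn, sub_self, sub_zero]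
  choose! T hT using step
  -- the sequences of errors `e i` and partial sums `S i`
  let e : ℕ → A := fun i ↦ Nat.rec a (fun j ej ↦ ej - (ψ (T j ej) - T j ej)) i
  have he0 : e 0 = a := rfl
  have hesucc : ∀ i, e (i + 1) = e i - (ψ (T i (e i)) - T i (e i)) := fun _ ↦ rfl
  have hinv : ∀ i, N (e i) ≤ θ ^ (i₀ + i + 1) ∧ normSum ψ n (e i) = 0 := by
    intro i
    induction i with
    | zero => exact ⟨by rw [he0, hi₀, add_zero], by rw [he0]; exact ha⟩
    | succ i ih =>
      obtain ⟨-, h2, h3⟩ := hT i (e i) ih.1 ih.2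
      rw [hesucc]
      exact ⟨by simpa [add_assoc] using h2, h3⟩
  have hTle : ∀ i, N (T i (e i)) ≤ θ ^ (i₀ + i + 1) := fun i ↦ (hT i (e i) (hinv i).1 (hinv i).2).1
  let S : ℕ → A := fun i ↦ ∑ j ∈ Finset.range i, T j (e j)
  have hSe : ∀ i, e i = a - (ψ (S i) - S i) := by
    intro i
    induction i with
    | zero => simp [S, he0]
    | succ i ih =>
      rw [hesucc]
      nth_rewrite 1 [ih]
      simp only [S, Finset.sum_range_succ, map_add]
      abel
  -- `S` is Cauchy: `N (S j - S i) ≤ θ^(i₀+i+1) ≤ θ^(i+1)`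
  have hθle1 : θ ≤ 1 := hθ1.le
  have hSdiff : ∀ i j, i ≤ j → N (S j - S i) ≤ θ ^ (i₀ + i + 1) := by
    intro i j hij
    induction j, hij using Nat.le_induction with
    | base => rw [sub_self, hNzero]; exact zero_le
    | succ j hij ih =>
      have : S (j + 1) - S i = T j (e j) + (S j - S i) := by
        simp only [S, Finset.sum_range_succ]; abel
      rw [this]
      refine (hNadd _ _).trans (max_le ((hTle j).trans ?_) ih)
      exact pow_le_pow_right_of_le_one' hθle1 (by omega)
  obtain ⟨Slim, hSlim⟩ := hcomplete S fun i j hij ↦ (hSdiff i j hij).trans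
    (pow_le_pow_right_of_le_one' hθle1 (by omega))
  refine ⟨Slim, ?_, ?_⟩
  · -- `ψ Slim - Slim = a`: the difference has `N` below every `θ^(i+1)`
    have hsmall : ∀ i, N (ψ Slim - Slim - a) ≤ θ ^ (i + 1) := by
      intro i
      have h1 : ψ Slim - Slim - a = (ψ (Slim - S i) - (Slim - S i)) - e i := by
        rw [hSe i, map_sub]; abel
      rw [h1]
      refine (hNsub _ _).trans (max_le ?_ ?_)
      · refine (hNsub _ _).trans (max_le ?_ ?_)
        · rw [hψN, ← hNneg, neg_sub]; exact hSlim i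
        · rw [← hNneg, neg_sub]; exact hSlim i
      · exact (hinv i).1.trans (pow_le_pow_right_of_le_one' hθle1 (by omega))
    have hzero : N (ψ Slim - Slim - a) = 0 := by
      by_contra hne
      obtain ⟨i, hi⟩ := hval _ (fun h ↦ hne ((hN0 _).mpr h))
      have hlt : θ ^ (i + 1 + 1) < θ ^ (i + 1) :=
        pow_lt_pow_right_of_lt_one₀ (lt_of_le_of_ne zero_le (by
          rintro rfl
          rw [zero_pow (Nat.succ_ne_zero _)] at hi
          exact hne hi)) hθ1 (by omega)
      have := hsmall (i + 1)
      rw [hi] at this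
      exact absurd this (not_le.mpr hlt)
    exact sub_eq_zero.mp ((hN0 _).mp hzero)
  · -- `N Slim ≤ N a = θ^(i₀+1)`
    have hS0 : S 0 = 0 := by simp [S]
    have h := hSlim 0
    rw [hS0, zero_sub, hNneg] at h
    have hS' : ∀ i, N (S i) ≤ θ ^ (i₀ + 1) := by
      intro i
      have := hSdiff 0 i (Nat.zero_le i)
      rwa [hS0, sub_zero, add_zero] at this
    -- `N Slim ≤ max (N (Slim - S i)) (N (S i))` for `i = i₀`... use any large `i`
    have : Slim = (Slim - S (i₀ + 1)) + S (i₀ + 1) := by abel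
    rw [hi₀, this]
    refine (hNadd _ _).trans (max_le ?_ (hS' _))
    rw [← hNneg, neg_sub]
    exact (hSlim (i₀ + 1)).trans (pow_le_pow_right_of_le_one' hθle1 (by omega))

end FilteredCoboundary

end Literature.NumberTheory.EllipticCurves
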